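import Literature.NumberTheory.Transcendental.AyoubPeriodSeries
import Literature.NumberTheory.Transcendental.AyoubPeriodSeriesKernel
import Literature.NumberTheory.Transcendental.AyoubPeriodSeriesPiAlgebraic
import Literature.NumberTheory.Transcendental.AyoubPeriodSeriesLocalizing
import Summits.KontsevichZagierPeriods.KontsevichZagierPeriods.Theorems.TypeAGenerationConjecture
import HarnessLib

/-!
# Sketch — crux idea `rational-shadow-residue-bridge` for crux `TypeAGeneration`
(stmt-KontsevichZagierPeriods-18392, route SymplecticScissors; ideator 1, round 1)

Typed shapes only (no proofs are claimed except the two small lemmas at the end):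

* `typeASpan σ`      — the type-(a) span `R_k = ⟨∂G/∂zᵢ − G|_{zᵢ=1} + G|_{zᵢ=0} : G ∈ 𝒪_{k-alg}(𝔻̄^∞)⟩_k`;
* `IsRationalGerm σ` — the germ is the expansion of `P/Q`, `Q(0) ≠ 0`, coefficients algebraic over `k`;
* `RationalShadow σ` — FIRST LEMMA of the line (provable, the bridge): every algebraic germ `F` is,
  modulo `R_k`, `(2πi)^N`-proportional to a RATIONAL germ `S` in more variables
  (étale chart + Grothendieck residue over a coordinate torus + Cartan homotopy certificates);
* `PiTorsionFree σ`  — `[2πi]^N` is a non-zero-divisor on `𝒪/R_k` (shared open item, AyoubSpecialisation);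
* `TypeARational σ`  — the crux restricted to rational germs (open, GPC-strength);
* `cardShape`        — `RationalShadow → PiTorsionFree → TypeARational → (crux conclusion at σ)`, PROVED;
* `smul_relAC_mem`   — scalar absorption: the `k`-structure of the span is immaterial (all instances
  of the crux with algebraic image have the same span), PROVED.
-/

noncomputable section

-- `Summit.KontsevichZagierPeriods.KontsevichZagierPeriods.…` is the tree's mandated layout (single-conjunct summit).
set_option linter.dupNamespace false

namespace Summit.KontsevichZagierPeriods.KontsevichZagierPeriods.Cruxes.TypeAGeneration.RationalShadow

open Literature.NumberTheory.Transcendental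
open Literature.NumberTheory.Transcendental.AyoubRel

variable {k : Type} [Field k] (σ : k →+* ℂ)

/-- The type-(a) generators `∂G/∂zᵢ − G|_{zᵢ=1} + G|_{zᵢ=0}`, `G ∈ 𝒪_{k-alg}(𝔻̄^∞)`. -/
def typeAGen : Set CSeries := {x : CSeries | ∃ G ∈ Oan σ, ∃ i : ℕ, x = relAC i G}

/-- The type-(a) span `R_k` (the `k`-span along `σ`), i.e. the conjectured kernel of `∫_{[0,1]^∞}`. -/
def typeASpan : Set CSeries := kSpan σ (typeAGen σ)

/-- `c ∈ ℂ` is algebraic over `k` along `σ`. -/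
def IsAlgConst (c : ℂ) : Prop := ∃ p : Polynomial k, p ≠ 0 ∧ Polynomial.eval₂ σ c p = 0

/-- `S ∈ ℂ[[z]]` is a RATIONAL germ over `k̄ ∩ ℂ`: `S · Q = P` for polynomials `P, Q` with coefficients
algebraic over `k` and `Q(0) ≠ 0` (so `S` is the Taylor expansion of `P/Q` at the corner). -/
def IsRationalGerm (S : CSeries) : Prop :=
  ∃ P Q : MvPolynomial ℕ ℂ, (∀ m, IsAlgConst σ (MvPolynomial.coeff m P)) ∧
    (∀ m, IsAlgConst σ (MvPolynomial.coeff m Q)) ∧ MvPolynomial.coeff 0 Q ≠ 0 ∧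
    S * (Q : MvPowerSeries ℕ ℂ) = (P : MvPowerSeries ℕ ℂ)

/-- `F` and `G` involve disjoint sets of variables (the "disjoint product" of the period algebra). -/
def DisjointVars (F G : CSeries) : Prop := ∀ i, ¬ (UsesVar F i ∧ UsesVar G i)

/-- RATIONAL SHADOW (first lemma of the line; claimed PROVABLE): for every `F ∈ 𝒪_{k-alg}(𝔻̄^∞)` there are
`N`, a rational germ `g` in fresh variables with `∫ g = (2πi)^N`, and a RATIONAL germ `S ∈ 𝒪_{k-alg}(𝔻̄^∞)`
with `g · F − S ∈ R_k`.  Mechanism: present `F` on an étale chart `U = {Φ = 0} ⊂ 𝔸ⁿ × 𝔸ᴺ` (Ayoub 2015,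
proof of Lemme 1.3); on each cell of a fine rational subdivision of `[0,1]ⁿ`, after a `ℚ̄`-linear change of
the `y`-coordinates, `F(z) = (2πi)^{-N} ∮_{|w_j|=δ} F̃(z,y) det(∂Φ/∂y) dy / ∏ Φ_j(z,y)` (Grothendieck residue
over a COORDINATE torus; uniform `δ` by compactness + étaleness); circles = pairs of rationally parametrised
arcs; the identity is certified inside type (a) by `N` iterated one-variable residue theorems for rational
functions (partial fractions split inside/outside, inversion `w ↦ δ²/v`, Cauchy shrinking as a Cartan homotopy
certificate) and by subdivision certificates (Cartan homotopy + reflection, Ayoub 2015 Rem. 1.5). -/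
def RationalShadow : Prop :=
  ∀ F ∈ Oan σ, ∃ (N : ℕ) (g S : CSeries),
    g ∈ Oan σ ∧ IsRationalGerm σ g ∧ DisjointVars g F ∧
    intC g = (2 * (Real.pi : ℂ) * Complex.I) ^ N ∧
    S ∈ Oan σ ∧ IsRationalGerm σ S ∧ g * F - S ∈ typeASpan σ

/-- π-TORSION-FREENESS of `𝒪_{k-alg}(𝔻̄^∞) ⧸ R_k` (open; the cube form of AyoubSpecialisation's
`PiCancellation`): if `g` lives in variables disjoint from `F`, `∫ g = (2πi)^N`, and `g · F ∈ R_k`,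
then `F ∈ R_k`. Implied by the crux (`∫(gF) = (2πi)^N ∫F`). -/
def PiTorsionFree : Prop :=
  ∀ (N : ℕ) (g : CSeries), g ∈ Oan σ → intC g = (2 * (Real.pi : ℂ) * Complex.I) ^ N →
    ∀ F ∈ Oan σ, DisjointVars g F → g * F ∈ typeASpan σ → F ∈ typeASpan σ

/-- The crux RESTRICTED TO RATIONAL GERMS (open, GPC-strength): a rational germ with algebraic
coefficients, pole-free on the closed unit polydisc, with `∫_{[0,1]^∞} S = 0`, lies in `R_k`. -/
def TypeARational : Prop :=
  ∀ S ∈ Oan σ, IsRationalGerm σ S → intC S = 0 → S ∈ typeASpan σ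

/-- The conclusion of the crux at the embedding `σ` (the crux is `∀ k σ, algebraic image → this`). -/
def CruxAt : Prop := ∀ F ∈ Oan σ, intC F = 0 → F ∈ typeASpan σ

/-- Sanity: the crux (tree leaf, `Iff.rfl` with `SymplecticScissors.TypeAGeneration`) is `∀ k σ, … → CruxAt σ`. -/
theorem typeAGenerationConjecture_iff_cruxAt :
    TypeAGenerationConjecture ↔
      ∀ (k : Type) [Field k] [CharZero k] (σ : k →+* ℂ), (∀ c : k, IsAlgebraic ℚ (σ c)) → CruxAt σ :=
  Iff.rfl

/-- `∫` vanishes on the type-(a) span (finite `k`-combinations of `relAC i G`, `G ∈ 𝒪`):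
the integrand of a finite combination is the combination of the integrands, each of which
has sum `0` (`hasSum_intC_relAC`). -/
theorem intC_eq_zero_of_mem_typeASpan {x : CSeries} (hx : x ∈ typeASpan σ) : intC x = 0 := by
  obtain ⟨n, c, s, hs, rfl⟩ := hx
  have hj : ∀ j ∈ (Finset.univ : Finset (Fin n)),
      HasSum (fun a : ℕ →₀ ℕ => σ (c j) * (MvPowerSeries.coeff a (s j) *
        ∏ i ∈ a.support, ((a i : ℂ) + 1)⁻¹)) (σ (c j) * 0) := by
    intro j _
    obtain ⟨G, hG, i, hG'⟩ := hs j
    rw [hG']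
    exact (hasSum_intC_relAC (summable_norm_coeff_of_mem_Oan σ hG) i).mul_left _
  have h := hasSum_sum hj
  simp only [mul_zero, Finset.sum_const_zero] at h
  rw [intC]
  refine HasSum.tsum_eq ?_
  refine h.congr_fun fun a => ?_
  rw [map_sum, Finset.sum_mul]
  refine Finset.sum_congr rfl fun j _ => ?_
  simp only [MvPowerSeries.coeff_smul, mul_assoc]

/-- SCALAR ABSORPTION: the type-(a) span is stable under constants algebraic over `k`
(`c • relAC i G = relAC i (c • G)` and `c • G ∈ 𝒪_{k-alg}`), so the `k`-structure of the crux is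
immaterial: every instance with algebraic image has the same span as the `k = ℚ` instance. -/
theorem smul_typeAGen_mem {c : ℂ} (hc : IsAlgConst σ c) {x : CSeries} (hx : x ∈ typeAGen σ) :
    c • x ∈ typeAGen σ := by
  obtain ⟨G, hG, i, rfl⟩ := hx
  exact ⟨c • G, smul_mem_Oan σ hc hG, i, (relAC_smul i c G).symm⟩

/-- THE CARD'S SHAPE (proved modulo the three named statements): rational shadow + π-torsion-freeness
reduce the crux at `σ` to its rational-germ case. -/
theorem cruxAt_of_rationalShadow (hRS : RationalShadow σ) (hPT : PiTorsionFree σ)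
    (hTR : TypeARational σ) : CruxAt σ := by
  intro F hF h0
  obtain ⟨N, g, S, hg, hgr, hdisj, hgi, hS, hSr, hmem⟩ := hRS F hF
  -- `∫(gF) = ∫g ∫F = 0` (disjoint variables), hence `∫S = ∫(gF) − ∫(gF − S) = 0`
  have hgF : intC (g * F) = 0 := by
    rw [intC_mul_of_disjoint (summable_norm_coeff_of_mem_Oan σ hg) (summable_norm_coeff_of_mem_Oan σ hF)
      hdisj, h0, mul_zero]
  have hgFmem : g * F ∈ Oan σ := mul_mem_Oan σ hg hF
  have hS0 : intC S = 0 := by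
    have h1 := intC_sub (summable_norm_coeff_of_mem_Oan σ hgFmem) (summable_norm_coeff_of_mem_Oan σ hS)
    rw [intC_eq_zero_of_mem_typeASpan σ hmem, hgF, zero_sub, eq_comm, neg_eq_zero] at h1
    exact h1
  have hSmem : S ∈ typeASpan σ := hTR S hS hSr hS0
  -- `gF = (gF − S) + S ∈ R_k` (the span is closed under addition), then cancel `g`
  have hgFspan : g * F ∈ typeASpan σ := by
    have : g * F = (g * F - S) + S := by ring
    rw [this]
    exact kSpan_add σ hmem hSmem
  exact hPT N g hg hgi F hF hdisj hgFspan

end Summit.KontsevichZagierPeriods.KontsevichZagierPeriods.Cruxes.TypeAGeneration.RationalShadow
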